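import Summits.CriticalPhenomena.PercolationContinuityZ3.Theorems.PercNearOneGluingNoHeavyLowerTailSahiChainTriangleClones
import Summits.CriticalPhenomena.PercolationContinuityZ3.Theorems.PercNearOneGluingNoHeavyLowerTailSahiChainTriangleGluing
import Mathlib.Tactic.Linarith
import Mathlib.Tactic.Ring
import HarnessLib

/-!
# `NoHeavyLowerTail` (crux stmt-CriticalPhenomena-4575), P2 — chain triangle, part 4/4: SAHI'S `C_3` FOR A TRIANGLE OF FUNCTIONS OVER THREE INDEPENDENT CHAINS

Memo SAHI-ROUTE.md §4.17 (seat `prim-masterthm-p2`, gen 5; `--supports stmt-CriticalPhenomena-4575`).  No `sorry`, no named facts, standard axioms.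

THE THEOREM (file `…SahiChainTriangle`): for probability weights `wA, wB, wC` on three finite LINEAR orders `α, β, γ` and nonnegative coordinatewise
increasing `f : γ → α → ℝ`, `g : γ → β → ℝ`, `h : α → β → ℝ` (a "triangle": each function sees two of three independent chains), under the product weight
on `α × β × γ`:  `2·E_3(f,g,h) ≥ P_A + P_B + P_C ≥ 0`, `P_C = Σ_{a,b} wA wB h·Cov_c(f(·,a),g(·,b))` etc.; in particular Sahi's `C_3` holds for this class
(Lieb–Sahi [LiebSahi2021, Thm 3.7] is the square — two chains; three chains are open in general).  PROOF: two independent clones per chain,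
`8P_X = E[S_X]`, `8(ΣP − E_3) = E[Δ²fΔ²gΔ²h]`, and the POINTWISE inequality `S_A+S_B+S_C ≥ 2Δ²fΔ²gΔ²h` on chains.

This part: `pointwise` (the 2×2×2 inequality for the actual functions, any clone configuration), `sahiE_three_eq_tau`
(`E_3 = 2τ(ABC) + τ(∅) − τ(A) − τ(B) − τ(C)` on `α × β × γ`), and the theorems **`two_mul_sahiE_three_ge`** (`2E_3 ≥ P_A+P_B+P_C`) and
**`sahiE_three_nonneg`** (`E_3 ≥ 0`). [cite: Sahi2008, Conj. 5; LiebSahi2021, Thm 3.7 (the square)]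
-/

noncomputable section

open scoped Classical

namespace Summit.CriticalPhenomena.PercolationContinuityZ3.Theorems

namespace SahiChainTriangle

open Finset
open Literature.Combinatorics.Sahi2008

/-! ### Assembly: the main theorem -/

section Main

variable {α β γ : Type} [Fintype α] [Fintype β] [Fintype γ] [LinearOrder α] [LinearOrder β] [LinearOrder γ]
  (wA : α → ℝ) (wB : β → ℝ) (wC : γ → ℝ) (f : γ → α → ℝ) (g : γ → β → ℝ) (h : α → β → ℝ)

omit [Fintype α] [Fintype β] [Fintype γ] in
/-- **THE POINTWISE INEQUALITIES for the actual functions**, any clone configuration (the chains make clones comparable):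
`0 ≤ S_C + S_A + S_B` and `2·Δ²fΔ²gΔ²h ≤ S_C + S_A + S_B`. [this work] -/
theorem pointwise
    (hf0 : ∀ c a, 0 ≤ f c a) (hg0 : ∀ c b, 0 ≤ g c b) (hh0 : ∀ a b, 0 ≤ h a b)
    (hf : ∀ c c' a a', c ≤ c' → a ≤ a' → f c a ≤ f c' a') (hg : ∀ c c' b b', c ≤ c' → b ≤ b' → g c b ≤ g c' b')
    (hh : ∀ a a' b b', a ≤ a' → b ≤ b' → h a b ≤ h a' b') (a a' : α) (b b' : β) (c c' : γ) :
    max 0 (2 * ((h a b - h a' b - h a b' + h a' b') * ((f c a - f c' a - f c a' + f c' a') * (g c b - g c' b - g c b' + g c' b')))) ≤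
      (h a b * ((f c a - f c' a) * (g c b - g c' b)) + h a b' * ((f c a - f c' a) * (g c b' - g c' b'))
        + h a' b * ((f c a' - f c' a') * (g c b - g c' b)) + h a' b' * ((f c a' - f c' a') * (g c b' - g c' b')))
      + (g c b * ((f c a - f c a') * (h a b - h a' b)) + g c b' * ((f c a - f c a') * (h a b' - h a' b'))
        + g c' b * ((f c' a - f c' a') * (h a b - h a' b)) + g c' b' * ((f c' a - f c' a') * (h a b' - h a' b')))
      + (f c a * ((g c b - g c b') * (h a b - h a b')) + f c a' * ((g c b - g c b') * (h a' b - h a' b'))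
        + f c' a * ((g c' b - g c' b') * (h a b - h a b')) + f c' a' * ((g c' b - g c' b') * (h a' b - h a' b'))) := by
  -- the oriented lemma (c₁ ≤ c₂, a₁ ≤ a₂, b₁ ≤ b₂) plus the nonnegativity of the twelve summands; both sides are invariant under each
  -- clone swap, which `linarith` sees after ring normalisation
  have key : ∀ (c₁ c₂ : γ) (a₁ a₂ : α) (b₁ b₂ : β), c₁ ≤ c₂ → a₁ ≤ a₂ → b₁ ≤ b₂ →
      2 * ((f c₂ a₂ - f c₁ a₂ - f c₂ a₁ + f c₁ a₁) * (g c₂ b₂ - g c₁ b₂ - g c₂ b₁ + g c₁ b₁) * (h a₂ b₂ - h a₁ b₂ - h a₂ b₁ + h a₁ b₁)) ≤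
        (h a₂ b₂ * ((f c₂ a₂ - f c₁ a₂) * (g c₂ b₂ - g c₁ b₂)) + h a₂ b₁ * ((f c₂ a₂ - f c₁ a₂) * (g c₂ b₁ - g c₁ b₁))
          + h a₁ b₂ * ((f c₂ a₁ - f c₁ a₁) * (g c₂ b₂ - g c₁ b₂)) + h a₁ b₁ * ((f c₂ a₁ - f c₁ a₁) * (g c₂ b₁ - g c₁ b₁)))
        + (g c₂ b₂ * ((f c₂ a₂ - f c₂ a₁) * (h a₂ b₂ - h a₁ b₂)) + g c₂ b₁ * ((f c₂ a₂ - f c₂ a₁) * (h a₂ b₁ - h a₁ b₁))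
          + g c₁ b₂ * ((f c₁ a₂ - f c₁ a₁) * (h a₂ b₂ - h a₁ b₂)) + g c₁ b₁ * ((f c₁ a₂ - f c₁ a₁) * (h a₂ b₁ - h a₁ b₁)))
        + (f c₂ a₂ * ((g c₂ b₂ - g c₂ b₁) * (h a₂ b₂ - h a₂ b₁)) + f c₂ a₁ * ((g c₂ b₂ - g c₂ b₁) * (h a₁ b₂ - h a₁ b₁))
          + f c₁ a₂ * ((g c₁ b₂ - g c₁ b₁) * (h a₂ b₂ - h a₂ b₁)) + f c₁ a₁ * ((g c₁ b₂ - g c₁ b₁) * (h a₁ b₂ - h a₁ b₁))) ∧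
      0 ≤ (h a₂ b₂ * ((f c₂ a₂ - f c₁ a₂) * (g c₂ b₂ - g c₁ b₂)) + h a₂ b₁ * ((f c₂ a₂ - f c₁ a₂) * (g c₂ b₁ - g c₁ b₁))
          + h a₁ b₂ * ((f c₂ a₁ - f c₁ a₁) * (g c₂ b₂ - g c₁ b₂)) + h a₁ b₁ * ((f c₂ a₁ - f c₁ a₁) * (g c₂ b₁ - g c₁ b₁)))
        + (g c₂ b₂ * ((f c₂ a₂ - f c₂ a₁) * (h a₂ b₂ - h a₁ b₂)) + g c₂ b₁ * ((f c₂ a₂ - f c₂ a₁) * (h a₂ b₁ - h a₁ b₁))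
          + g c₁ b₂ * ((f c₁ a₂ - f c₁ a₁) * (h a₂ b₂ - h a₁ b₂)) + g c₁ b₁ * ((f c₁ a₂ - f c₁ a₁) * (h a₂ b₁ - h a₁ b₁)))
        + (f c₂ a₂ * ((g c₂ b₂ - g c₂ b₁) * (h a₂ b₂ - h a₂ b₁)) + f c₂ a₁ * ((g c₂ b₂ - g c₂ b₁) * (h a₁ b₂ - h a₁ b₁))
          + f c₁ a₂ * ((g c₁ b₂ - g c₁ b₁) * (h a₂ b₂ - h a₂ b₁)) + f c₁ a₁ * ((g c₁ b₂ - g c₁ b₁) * (h a₁ b₂ - h a₁ b₁))) := by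
    intro c₁ c₂ a₁ a₂ b₁ b₂ hc ha hb
    refine ⟨pointwise_oriented (f c₁ a₁) (f c₁ a₂) (f c₂ a₁) (f c₂ a₂) (g c₁ b₁) (g c₁ b₂) (g c₂ b₁) (g c₂ b₂)
        (h a₁ b₁) (h a₁ b₂) (h a₂ b₁) (h a₂ b₂)
        (hf0 _ _) (hf _ _ _ _ le_rfl ha) (hf _ _ _ _ hc le_rfl) (hf _ _ _ _ hc le_rfl) (hf _ _ _ _ le_rfl ha)
        (hg0 _ _) (hg _ _ _ _ le_rfl hb) (hg _ _ _ _ hc le_rfl) (hg _ _ _ _ hc le_rfl) (hg _ _ _ _ le_rfl hb)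
        (hh0 _ _) (hh _ _ _ _ le_rfl hb) (hh _ _ _ _ ha le_rfl) (hh _ _ _ _ ha le_rfl) (hh _ _ _ _ le_rfl hb), ?_⟩
    have x1 : 0 ≤ f c₂ a₂ - f c₁ a₂ := by linarith [hf _ _ _ _ hc (le_refl a₂)]
    have x0 : 0 ≤ f c₂ a₁ - f c₁ a₁ := by linarith [hf _ _ _ _ hc (le_refl a₁)]
    have u1 : 0 ≤ f c₂ a₂ - f c₂ a₁ := by linarith [hf c₂ c₂ _ _ le_rfl ha]
    have u0 : 0 ≤ f c₁ a₂ - f c₁ a₁ := by linarith [hf c₁ c₁ _ _ le_rfl ha]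
    have y1 : 0 ≤ g c₂ b₂ - g c₁ b₂ := by linarith [hg _ _ _ _ hc (le_refl b₂)]
    have y0 : 0 ≤ g c₂ b₁ - g c₁ b₁ := by linarith [hg _ _ _ _ hc (le_refl b₁)]
    have v1 : 0 ≤ g c₂ b₂ - g c₂ b₁ := by linarith [hg c₂ c₂ _ _ le_rfl hb]
    have v0 : 0 ≤ g c₁ b₂ - g c₁ b₁ := by linarith [hg c₁ c₁ _ _ le_rfl hb]
    have z1 : 0 ≤ h a₂ b₂ - h a₁ b₂ := by linarith [hh _ _ _ _ ha (le_refl b₂)]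
    have z0 : 0 ≤ h a₂ b₁ - h a₁ b₁ := by linarith [hh _ _ _ _ ha (le_refl b₁)]
    have q1 : 0 ≤ h a₂ b₂ - h a₂ b₁ := by linarith [hh a₂ a₂ _ _ le_rfl hb]
    have q0 : 0 ≤ h a₁ b₂ - h a₁ b₁ := by linarith [hh a₁ a₁ _ _ le_rfl hb]
    linarith [mul_nonneg (hh0 a₂ b₂) (mul_nonneg x1 y1), mul_nonneg (hh0 a₂ b₁) (mul_nonneg x1 y0),
      mul_nonneg (hh0 a₁ b₂) (mul_nonneg x0 y1), mul_nonneg (hh0 a₁ b₁) (mul_nonneg x0 y0),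
      mul_nonneg (hg0 c₂ b₂) (mul_nonneg u1 z1), mul_nonneg (hg0 c₂ b₁) (mul_nonneg u1 z0),
      mul_nonneg (hg0 c₁ b₂) (mul_nonneg u0 z1), mul_nonneg (hg0 c₁ b₁) (mul_nonneg u0 z0),
      mul_nonneg (hf0 c₂ a₂) (mul_nonneg v1 q1), mul_nonneg (hf0 c₂ a₁) (mul_nonneg v1 q0),
      mul_nonneg (hf0 c₁ a₂) (mul_nonneg v0 q1), mul_nonneg (hf0 c₁ a₁) (mul_nonneg v0 q0)]
  rw [max_le_iff]
  rcases le_total c' c with hc | hc <;> rcases le_total a' a with ha | ha <;> rcases le_total b' b with hb | hb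
  · obtain ⟨k1, k2⟩ := key c' c a' a b' b hc ha hb; constructor <;> linarith
  · obtain ⟨k1, k2⟩ := key c' c a' a b b' hc ha hb; constructor <;> linarith
  · obtain ⟨k1, k2⟩ := key c' c a a' b' b hc ha hb; constructor <;> linarith
  · obtain ⟨k1, k2⟩ := key c' c a a' b b' hc ha hb; constructor <;> linarith
  · obtain ⟨k1, k2⟩ := key c c' a' a b' b hc ha hb; constructor <;> linarith
  · obtain ⟨k1, k2⟩ := key c c' a' a b b' hc ha hb; constructor <;> linarith
  · obtain ⟨k1, k2⟩ := key c c' a a' b' b hc ha hb; constructor <;> linarith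
  · obtain ⟨k1, k2⟩ := key c c' a a' b b' hc ha hb; constructor <;> linarith

omit [LinearOrder α] [LinearOrder β] [LinearOrder γ] in
/-- **`E_3` of the triangle in the gluing patterns**: `E_3 = 2τ(ABC) + τ(∅) − τ(A) − τ(B) − τ(C)` (product weight on `α × β × γ`). [this work] -/
theorem sahiE_three_eq_tau (hA : ∑ a, wA a = 1) (hB : ∑ b, wB b = 1) (hC : ∑ c, wC c = 1) :
    sahiE (fun p : α × β × γ => wA p.1 * wB p.2.1 * wC p.2.2) 3
        ![fun p => f p.2.2 p.1, fun p => g p.2.2 p.2.1, fun p => h p.1 p.2.1] =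
      2 * tauABC wA wB wC f g h + tau0 wA wB wC f g h - (tauB wA wB wC f g h + tauA wA wB wC f g h + tauC wA wB wC f g h) := by
  rw [sahiE_three]
  simp only [ex_prod3, Pi.mul_apply]
  -- the five atoms
  have e3 : (∑ a, ∑ b, ∑ c, wA a * wB b * wC c * (f c a * g c b * h a b)) = tauABC wA wB wC f g h := by
    rw [tauABC]; exact (E6_of_abc wA wB wC hA hB hC fun a b c => f c a * g c b * h a b).symm
  have eF : (∑ a, ∑ b, ∑ c, wA a * wB b * wC c * f c a) = ∑ a, ∑ c, wA a * wC c * f c a := drop_b wA wB wC hB fun a c => f c a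
  have eG : (∑ a, ∑ b, ∑ c, wA a * wB b * wC c * g c b) = ∑ b, ∑ c, wB b * wC c * g c b := drop_a wA wB wC hA fun b c => g c b
  have eH : (∑ a, ∑ b, ∑ c, wA a * wB b * wC c * h a b) = ∑ a, ∑ b, wA a * wB b * h a b := drop_c wA wB wC hC h
  have e0 : tau0 wA wB wC f g h =
      (∑ a, ∑ c, wA a * wC c * f c a) * (∑ b, ∑ c, wB b * wC c * g c b) * ∑ a, ∑ b, wA a * wB b * h a b := by
    rw [tau0]; exact E6_prod3 wA wB wC (fun a c => f c a) (fun b c => g c b) h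
  have eB : (∑ a, ∑ b, ∑ c, wA a * wB b * wC c * f c a) * (∑ a, ∑ b, ∑ c, wA a * wB b * wC c * (g c b * h a b)) =
      tauB wA wB wC f g h := by
    rw [← E6_prod wA wB wC (fun a b c => f c a) (fun a b c => g c b * h a b), tauB,
      ← E6_swap_b wA wB wC (fun a a' b b' c c' => f c a * g c' b * h a' b)]
    exact E6_congr wA wB wC fun _ _ _ _ _ _ => by ring
  have eA : (∑ a, ∑ b, ∑ c, wA a * wB b * wC c * g c b) * (∑ a, ∑ b, ∑ c, wA a * wB b * wC c * (f c a * h a b)) =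
      tauA wA wB wC f g h := by
    rw [← E6_prod wA wB wC (fun a b c => g c b) (fun a b c => f c a * h a b), tauA,
      ← E6_swap_a wA wB wC (fun a a' b b' c c' => f c a * g c' b * h a b'),
      ← E6_swap_c wA wB wC (fun a a' b b' c c' => f c a' * g c' b * h a' b')]
    exact E6_congr wA wB wC fun _ _ _ _ _ _ => by ring
  have eC : (∑ a, ∑ b, ∑ c, wA a * wB b * wC c * h a b) * (∑ a, ∑ b, ∑ c, wA a * wB b * wC c * (f c a * g c b)) =
      tauC wA wB wC f g h := by
    rw [← E6_prod wA wB wC (fun a b c => h a b) (fun a b c => f c a * g c b), tauC,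
      ← E6_swap_a wA wB wC (fun a a' b b' c c' => f c a * g c b * h a' b'),
      ← E6_swap_b wA wB wC (fun a a' b b' c c' => f c a' * g c b * h a b'),
      ← E6_swap_c wA wB wC (fun a a' b b' c c' => f c a' * g c b' * h a b)]
    exact E6_congr wA wB wC fun _ _ _ _ _ _ => by ring
  rw [e3, ← eB, ← eA, ← eC, e0, eF, eG, eH]

/-- **THEOREM (Sahi's `C_3`, quantitative, for a triangle over three chains): `2·E_3(f,g,h) ≥ P_A + P_B + P_C`**, where
`P_C = Σ_{a,b} wA wB h(a,b) Cov_c(f(·,a),g(·,b))`, `P_A = Σ_{c,b} wC wB g(c,b) Cov_a(f(c,·),h(·,b))`, `P_B = Σ_{c,a} wC wA f(c,a) Cov_b(g(c,·),h(a,·))`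
(each `≥ 0` on chains).  Hypotheses: probability weights on three finite linear orders, `f,g,h ≥ 0` and monotone in each argument. [this work] -/
theorem two_mul_sahiE_three_ge (hA0 : ∀ a, 0 ≤ wA a) (hB0 : ∀ b, 0 ≤ wB b) (hC0 : ∀ c, 0 ≤ wC c)
    (hA : ∑ a, wA a = 1) (hB : ∑ b, wB b = 1) (hC : ∑ c, wC c = 1)
    (hf0 : ∀ c a, 0 ≤ f c a) (hg0 : ∀ c b, 0 ≤ g c b) (hh0 : ∀ a b, 0 ≤ h a b)
    (hf : ∀ c c' a a', c ≤ c' → a ≤ a' → f c a ≤ f c' a') (hg : ∀ c c' b b', c ≤ c' → b ≤ b' → g c b ≤ g c' b')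
    (hh : ∀ a a' b b', a ≤ a' → b ≤ b' → h a b ≤ h a' b') :
    (∑ c, ∑ b, wC c * wB b * (g c b * ((∑ a, wA a * (f c a * h a b)) - (∑ a, wA a * f c a) * ∑ a, wA a * h a b)))
      + (∑ c, ∑ a, wC c * wA a * (f c a * ((∑ b, wB b * (g c b * h a b)) - (∑ b, wB b * g c b) * ∑ b, wB b * h a b)))
      + (∑ a, ∑ b, wA a * wB b * (h a b * ((∑ c, wC c * (f c a * g c b)) - (∑ c, wC c * f c a) * ∑ c, wC c * g c b)))
      ≤ 2 * sahiE (fun p : α × β × γ => wA p.1 * wB p.2.1 * wC p.2.2) 3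
          ![fun p => f p.2.2 p.1, fun p => g p.2.2 p.2.1, fun p => h p.1 p.2.1] := by
  -- the four integrands
  set SC : α → α → β → β → γ → γ → ℝ := fun a a' b b' c c' =>
    h a b * ((f c a - f c' a) * (g c b - g c' b)) + h a b' * ((f c a - f c' a) * (g c b' - g c' b'))
      + h a' b * ((f c a' - f c' a') * (g c b - g c' b)) + h a' b' * ((f c a' - f c' a') * (g c b' - g c' b')) with hSC
  set SA : α → α → β → β → γ → γ → ℝ := fun a a' b b' c c' =>
    g c b * ((f c a - f c a') * (h a b - h a' b)) + g c b' * ((f c a - f c a') * (h a b' - h a' b'))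
      + g c' b * ((f c' a - f c' a') * (h a b - h a' b)) + g c' b' * ((f c' a - f c' a') * (h a b' - h a' b')) with hSA
  set SB : α → α → β → β → γ → γ → ℝ := fun a a' b b' c c' =>
    f c a * ((g c b - g c b') * (h a b - h a b')) + f c a' * ((g c b - g c b') * (h a' b - h a' b'))
      + f c' a * ((g c' b - g c' b') * (h a b - h a b')) + f c' a' * ((g c' b - g c' b') * (h a' b - h a' b')) with hSB
  set D : α → α → β → β → γ → γ → ℝ := fun a a' b b' c c' =>
    (h a b - h a' b - h a b' + h a' b') * ((f c a - f c' a - f c a' + f c' a') * (g c b - g c' b - g c b' + g c' b')) with hD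
  -- positivity of the clone integral
  have hpos : 0 ≤ E6 wA wB wC (fun a a' b b' c c' => SC a a' b b' c c' + SA a a' b b' c c' + SB a a' b b' c c' - 2 * D a a' b b' c c') := by
    refine E6_nonneg wA wB wC hA0 hB0 hC0 fun a a' b b' c c' => ?_
    have hp := pointwise f g h hf0 hg0 hh0 hf hg hh a a' b b' c c'
    rw [max_le_iff] at hp
    simp only [hSC, hSA, hSB, hD]
    linarith [hp.2]
  have hlin : E6 wA wB wC (fun a a' b b' c c' => SC a a' b b' c c' + SA a a' b b' c c' + SB a a' b b' c c' - 2 * D a a' b b' c c') =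
      E6 wA wB wC SC + E6 wA wB wC SA + E6 wA wB wC SB - 2 * E6 wA wB wC D := by
    simp only [E6_sub, E6_add, E6_smul]
  -- the readable `P`'s
  have ePC : E6 wA wB wC SC = 8 * ∑ a, ∑ b, wA a * wB b * (h a b * ((∑ c, wC c * (f c a * g c b)) - (∑ c, wC c * f c a) * ∑ c, wC c * g c b)) := by
    simp only [hSC]; unfold E6; exact esum_S_pattern wC wA wB hC hA hB f g h
  have ePA : E6 wA wB wC SA = 8 * ∑ c, ∑ b, wC c * wB b * (g c b * ((∑ a, wA a * (f c a * h a b)) - (∑ a, wA a * f c a) * ∑ a, wA a * h a b)) := by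
    simp only [hSA]; rw [E6_cba]; exact esum_S_pattern wA wC wB hA hC hB (fun a c => f c a) (fun a b => h a b) (fun c b => g c b)
  have ePB : E6 wA wB wC SB = 8 * ∑ c, ∑ a, wC c * wA a * (f c a * ((∑ b, wB b * (g c b * h a b)) - (∑ b, wB b * g c b) * ∑ b, wB b * h a b)) := by
    simp only [hSB]; rw [E6_cab]; exact esum_S_pattern wB wC wA hB hC hA (fun b c => g c b) (fun b a => h a b) (fun c a => f c a)
  -- the gluing patterns
  have tC : E6 wA wB wC SC = 8 * (tauABC wA wB wC f g h - tauAB wA wB wC f g h) := by simp only [hSC]; exact esum_SC wA wB wC f g h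
  have tA : E6 wA wB wC SA = 8 * (tauABC wA wB wC f g h - tauBC wA wB wC f g h) := by simp only [hSA]; exact esum_SA wA wB wC f g h
  have tB : E6 wA wB wC SB = 8 * (tauABC wA wB wC f g h - tauAC wA wB wC f g h) := by simp only [hSB]; exact esum_SB wA wB wC f g h
  have tD : E6 wA wB wC D = 8 * (tauABC wA wB wC f g h - tauAB wA wB wC f g h - tauAC wA wB wC f g h - tauBC wA wB wC f g h
      + tauA wA wB wC f g h + tauB wA wB wC f g h + tauC wA wB wC f g h - tau0 wA wB wC f g h) := by
    simp only [hD]; exact esum_D wA wB wC f g h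
  have tE := sahiE_three_eq_tau wA wB wC f g h hA hB hC
  rw [hlin] at hpos
  linarith

/-- **COROLLARY: Sahi's `C_3` holds for every triangle of nonnegative monotone functions over three independent finite chains.** [this work] -/
theorem sahiE_three_nonneg (hA0 : ∀ a, 0 ≤ wA a) (hB0 : ∀ b, 0 ≤ wB b) (hC0 : ∀ c, 0 ≤ wC c)
    (hA : ∑ a, wA a = 1) (hB : ∑ b, wB b = 1) (hC : ∑ c, wC c = 1)
    (hf0 : ∀ c a, 0 ≤ f c a) (hg0 : ∀ c b, 0 ≤ g c b) (hh0 : ∀ a b, 0 ≤ h a b)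
    (hf : ∀ c c' a a', c ≤ c' → a ≤ a' → f c a ≤ f c' a') (hg : ∀ c c' b b', c ≤ c' → b ≤ b' → g c b ≤ g c' b')
    (hh : ∀ a a' b b', a ≤ a' → b ≤ b' → h a b ≤ h a' b') :
    0 ≤ sahiE (fun p : α × β × γ => wA p.1 * wB p.2.1 * wC p.2.2) 3
      ![fun p => f p.2.2 p.1, fun p => g p.2.2 p.2.1, fun p => h p.1 p.2.1] := by
  have hmain := two_mul_sahiE_three_ge wA wB wC f g h hA0 hB0 hC0 hA hB hC hf0 hg0 hh0 hf hg hh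
  -- the P's are nonnegative: sum of the three clone integrals of S_C, S_A, S_B, each pointwise ≥ 0
  set SC : α → α → β → β → γ → γ → ℝ := fun a a' b b' c c' =>
    h a b * ((f c a - f c' a) * (g c b - g c' b)) + h a b' * ((f c a - f c' a) * (g c b' - g c' b'))
      + h a' b * ((f c a' - f c' a') * (g c b - g c' b)) + h a' b' * ((f c a' - f c' a') * (g c b' - g c' b')) with hSC
  set SA : α → α → β → β → γ → γ → ℝ := fun a a' b b' c c' =>
    g c b * ((f c a - f c a') * (h a b - h a' b)) + g c b' * ((f c a - f c a') * (h a b' - h a' b'))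
      + g c' b * ((f c' a - f c' a') * (h a b - h a' b)) + g c' b' * ((f c' a - f c' a') * (h a b' - h a' b')) with hSA
  set SB : α → α → β → β → γ → γ → ℝ := fun a a' b b' c c' =>
    f c a * ((g c b - g c b') * (h a b - h a b')) + f c a' * ((g c b - g c b') * (h a' b - h a' b'))
      + f c' a * ((g c' b - g c' b') * (h a b - h a b')) + f c' a' * ((g c' b - g c' b') * (h a' b - h a' b')) with hSB
  have hpos : 0 ≤ E6 wA wB wC (fun a a' b b' c c' => SC a a' b b' c c' + SA a a' b b' c c' + SB a a' b b' c c') := by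
    refine E6_nonneg wA wB wC hA0 hB0 hC0 fun a a' b b' c c' => ?_
    have hp := pointwise f g h hf0 hg0 hh0 hf hg hh a a' b b' c c'
    rw [max_le_iff] at hp
    simp only [hSC, hSA, hSB]
    linarith [hp.1]
  have hlin : E6 wA wB wC (fun a a' b b' c c' => SC a a' b b' c c' + SA a a' b b' c c' + SB a a' b b' c c') =
      E6 wA wB wC SC + E6 wA wB wC SA + E6 wA wB wC SB := by simp only [E6_add]
  have ePC : E6 wA wB wC SC = 8 * ∑ a, ∑ b, wA a * wB b * (h a b * ((∑ c, wC c * (f c a * g c b)) - (∑ c, wC c * f c a) * ∑ c, wC c * g c b)) := by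
    simp only [hSC]; unfold E6; exact esum_S_pattern wC wA wB hC hA hB f g h
  have ePA : E6 wA wB wC SA = 8 * ∑ c, ∑ b, wC c * wB b * (g c b * ((∑ a, wA a * (f c a * h a b)) - (∑ a, wA a * f c a) * ∑ a, wA a * h a b)) := by
    simp only [hSA]; rw [E6_cba]; exact esum_S_pattern wA wC wB hA hC hB (fun a c => f c a) (fun a b => h a b) (fun c b => g c b)
  have ePB : E6 wA wB wC SB = 8 * ∑ c, ∑ a, wC c * wA a * (f c a * ((∑ b, wB b * (g c b * h a b)) - (∑ b, wB b * g c b) * ∑ b, wB b * h a b)) := by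
    simp only [hSB]; rw [E6_cab]; exact esum_S_pattern wB wC wA hB hC hA (fun b c => g c b) (fun b a => h a b) (fun c a => f c a)
  rw [hlin] at hpos
  linarith

end Main

end SahiChainTriangle

end Summit.CriticalPhenomena.PercolationContinuityZ3.Theorems
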